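import Literature.NumberTheory.Automorphic.LocalAntiInvariantCharacterFactorisation
import Literature.NumberTheory.Automorphic.Liu2021.LemD1AsPrintedIndexedNonVacuityTameTwistCM
import Literature.NumberTheory.Rogawski1990.SemilocalQuadraticCharExtension
import Literature.NumberTheory.Automorphic.TorusCharacterLocalComponents
import Literature.NumberTheory.Automorphic.AnisotropicUnitaryGroupCompactOfPlace
import Literature.NumberTheory.Automorphic.UnitaryGroupInertPlaceHyperbolicBasis
import Literature.NumberTheory.ComplexMultiplication.CMTypeCount
import Mathlib.Topology.Algebra.Group.Units
import HarnessLib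

/-!
# Local components of conjugate-symplectic Hecke characters exhaust the `ω`-type local characters at a non-split place

Topic `NumberTheory/Automorphic`; namespace `Literature.NumberTheory.Automorphic.IdeleClassGroup` (+ one bookkeeping lemma in `….UnitaryGroup`).
THEOREMS ONLY (no definition, no instance, no notation, no named fact, no `sorry`).  Cell `hodgecm-mathlib` (D-0151), seat B-p14 (g28), F0P2-plan (g8)
«=» 2026-08-31T20:42:59Z; kernel lane `--supports stmt-HodgeConjecture-24833`.

THE STATEMENT (`IdeleClassGroup.exists_isConjugateSymplectic_semilocalComponent_eq`).  `L` a CM field, `v` a finite place of `L⁺` NOT split in `L`,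
`μ′ : (L ⊗ L⁺_v)ˣ → ℂˣ` continuous with `μ′|_{L⁺_vˣ} = ω_{L_v/L⁺_v}` (★ `UnitaryGroup.IsQuadraticCharExtension`, the standing hypothesis «`μ|F* = ω_{E/F}`»
of [Rogawski1990, §4.8 p. 51; §12.2 p. 173] on the local `μ`).  Then `μ′ = (toHeckeCharacter L μ)_v` (★ `HeckeCharacter.semilocalComponent`, the
`μ`-slot of ★ `cmXiTorusChar`) for some CONJUGATE-SYMPLECTIC `μ : C_L → S¹` ([Liu2021, Def. 4.1]).  So every local letter stated at «the
`v`-component of a global conjugate-symplectic `μ`» (e.g. ★ `GelbartRogawski1991.thetaType_nonsplit_jacquetModule`, the K1∕T7 lines) reaches EVERY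
local `μ′` of the local letters stated at an arbitrary `ω`-type character (★ `Rogawski1990.KeysCaseTwoReducible`, ★ `Rogawski1990.KeysCaseTwo`).

THE PROOF.  Any conjugate-symplectic `ψ₀` exists (★ `exists_isConjugateSymplectic_hasInfinityType`); `λ := μ′/ψ₀,v` kills the `c ⊗ 1`-fixed units
(both restrictions are the `±1`-valued local norm character: ★ `isQuadraticCharExtension_semilocalComponent_of_baseChange_eq`, and `x² = x · c̄x`
is a norm); read at the unique place `w ∣ v` (★ `PlacesOver.subsingleton_of_smul_eq`, ★ `conjLocal_apply_eq_of_smul_eq`) it is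
`θ_w ∘ (x ↦ x/c̄x)` for a finite-order open-kernel `θ_w` (★ `LocalAntiInvariantCharacter.exists_isOfFinOrder_apply_mul_inv_eq`); globalise
`θ_w` to a finite-order Hecke character `θ` ([ClozelHarrisTaylor2008, Lem. 4.1.1] ★ `exists_heckeCharacter_isFiniteOrder_localComponent_eq`) and twist:
`μ := ψ₀ · θ̃ · (θ̃ ∘ c)⁻¹` is conjugate symplectic with `μ_v = ψ₀,v · θ_w(x_w/c̄x_w) = μ′` (★ `exists_twist_of_isFiniteOrder`, ★ `localMu_mul_twist_apply`).
This is the «companion with PRESCRIBED local label» that ★ `LemD1AsPrintedIndexedNonVacuityTameTwistCM` proves up to a tame sign.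
HONEST LABEL: HC_CM is proved only modulo the printed citations until rung 0 closes; this file discharges none of them by itself.

## Mathlib / tree search
Tree (★, by name): `ConjugateSelfDualCharacters` (`exists_isConjugateSymplectic_hasInfinityType`), `OscillatorConventions`
(`isOscillatorChar_toHeckeCharacter_iff`), `Rogawski1990/SemilocalQuadraticCharExtension`, `TorusCharacterLocalComponents` (`semilocalComponent_eq_prod`,
`continuous_semilocalComponent`), `GelbartRogawski1991/CMSplittingCharLocalMu` (`localMu`), `Liu2021/LemD1AsPrintedIndexedNonVacuityTameTwistCM`
(`exists_twist_of_isFiniteOrder`, `localMu_mul_twist_apply`), `GaloisRepresentations/CharacterPrescribedLocalComponentsProofs` (CHT 4.1.1),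
`UnitaryGroupInertPlaceHyperbolicBasis` (`galAdicCompletionMap_galAdicCompletionMap_of_smul_eq`), `GaloisActionPlaces` (`valued_galAdicCompletionMap`).
Mathlib: `ContinuousMulEquiv.piUnits`, `continuous_mulSingle`, `Units.isEmbedding_val₀`, `mul_self_eq_one_iff`.
`lean search 'IsConjugateSymplectic.*semilocalComponent|semilocalComponent_eq.*∃'`: no existence statement with a PRESCRIBED component in the tree.

## References
* [Rogawski1990] J. Rogawski, *Automorphic Representations of Unitary Groups in Three Variables*, Ann. of Math. Stud. 123 (1990), §4.8 p. 51, §12.2 p. 173.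
* [Liu2021] Y. Liu, *Fourier–Jacobi cycles and arithmetic relative trace formula*, Camb. J. Math. 9 (2021) = arXiv:2102.11518, Def. 4.1, Def. 4.11.
* [ClozelHarrisTaylor2008] L. Clozel, M. Harris, R. Taylor, Publ. Math. IHÉS 108 (2008), Lemma 4.1.1 (p. 116).
* [CasselsFrohlichANT1967] J. W. S. Cassels, A. Fröhlich (eds.), *Algebraic Number Theory* (1967), Ch. VII §5 (Größencharaktere).
-/

set_option autoImplicit false

noncomputable section

open NumberField IsDedekindDomain
open scoped Topology

namespace Literature.NumberTheory.Automorphic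

namespace IdeleClassGroup

/-! ## §2 Two units of square one with the same kernel condition coincide -/

/-- `a² = b² = 1` and `a = 1 ↔ b = 1` force `a = b` in `ℂˣ` (both are `±1`). [folklore] -/
private theorem units_eq_of_sq_eq_one {a b : ℂˣ} (ha : a ^ 2 = 1) (hb : b ^ 2 = 1) (h : a = 1 ↔ b = 1) : a = b := by
  have ha' : (a : ℂ) = 1 ∨ (a : ℂ) = -1 :=
    mul_self_eq_one_iff.1 (by rw [← sq, ← Units.val_pow_eq_pow_val, ha, Units.val_one])
  have hb' : (b : ℂ) = 1 ∨ (b : ℂ) = -1 :=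
    mul_self_eq_one_iff.1 (by rw [← sq, ← Units.val_pow_eq_pow_val, hb, Units.val_one])
  have ha1 : a = 1 ↔ (a : ℂ) = 1 := by rw [← Units.val_inj, Units.val_one]
  have hb1 : b = 1 ↔ (b : ℂ) = 1 := by rw [← Units.val_inj, Units.val_one]
  apply Units.ext
  rcases ha' with ha' | ha'
  · rw [ha', eq_comm]; exact hb1.1 (h.1 (ha1.2 ha'))
  · rcases hb' with hb' | hb'
    · exact absurd (ha1.1 (h.2 (hb1.2 hb'))) (by rw [ha']; norm_num)
    · rw [ha', hb']

/-! ## §3 The CM field: every local character `μ′` of `(L ⊗ L⁺_v)ˣ` with `μ′|_{L⁺_vˣ} = ω_v` is a local component of a conjugate-symplectic character -/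

section CM

open Literature.NumberTheory.GaloisRepresentations (HeckeCharacter ideleGroup localUnits)
open Literature.NumberTheory.GelbartRogawski1991.UnitaryDualPair.LocalSplitting (localMu localMu_apply)
open Literature.NumberTheory.Automorphic.Liu2021.LemD1IndexedNonVacuityTameTwistCM (exists_twist_of_isFiniteOrder localMu_mul_twist_apply)
open Literature.RepresentationTheory.Liu2021 (isOscillatorChar_toHeckeCharacter_iff)
open Literature.NumberTheory.ComplexMultiplication (CMTypeCount.nonempty_cmType_iff_isTotallyComplex)

variable (L : Type) [Field L] [NumberField L] [IsCMField L]

omit [IsCMField L] in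
/-- The μ-slot `χ.semilocalComponent L v` of ★ `cmXiTorusChar` IS the tree's `localMu L χ v` ([Liu2021, Def. 4.11] «`μ = ⊗ μ_v`»): both are
`x ↦ ∏_{w ∣ v} χ_w(x_w)`. [cite: Liu2021, Def. 4.11 (l. 2086)] [cite: TateThesis1967, §4.3] -/
theorem semilocalComponent_eq_localMu (χ : HeckeCharacter L) (v : HeightOneSpectrum (𝓞 ↥(maximalRealSubfield L))) :
    χ.semilocalComponent L v = localMu L χ v := by
  refine MonoidHom.ext fun x => ?_
  rw [UnitaryGroup.semilocalComponent_eq_prod, localMu_apply]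
  refine Finset.prod_congr rfl fun w _ => ?_
  rw [HeckeCharacter.localComponent_apply]
  exact congrArg _ (congrArg _ (Units.ext rfl))

/-- **Local components of conjugate-symplectic characters exhaust the `ω`-type local characters.**  Let `L` be a CM field, `v` a finite place
of `L⁺` NOT split in `L`, and `μ′ : (L ⊗ L⁺_v)ˣ → ℂˣ` a continuous character whose restriction to `L⁺_vˣ` is the quadratic character of `L_v/L⁺_v`
(★ `UnitaryGroup.IsQuadraticCharExtension`).  Then `μ′` is the `v`-component (★ `HeckeCharacter.semilocalComponent`, the `μ`-slot of ★ `cmXiTorusChar`) of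
`toHeckeCharacter L μ` for some CONJUGATE-SYMPLECTIC `μ : C_L → S¹` ([Liu2021, Def. 4.1]: `μ|_{𝔸_{L⁺}^×} = μ_{L/L⁺}`; [Rogawski1990, §4.8]: «a fixed
character of `C_E` whose restriction to `C_F` is `ω_{E/F}`»).  Proof: start from any conjugate-symplectic `ψ₀` (★ `exists_isConjugateSymplectic_hasInfinityType`);
`λ := μ′ ∕ ψ₀,v` kills `L⁺_vˣ` (both restrictions are the `±1`-valued norm character, ★ `isQuadraticCharExtension_semilocalComponent_of_baseChange_eq`),
so by §1 `λ = θ_w ∘ (x ↦ x ∕ c̄x)` for a finite-order open-kernel `θ_w` of `L_wˣ`; globalise `θ_w` to a finite-order Hecke character `θ`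
([ClozelHarrisTaylor2008, Lem. 4.1.1], ★ `exists_heckeCharacter_isFiniteOrder_localComponent_eq`) and twist: `μ := ψ₀ · θ̃ · (θ̃ ∘ c)⁻¹`
(★ `exists_twist_of_isFiniteOrder`, ★ `localMu_mul_twist_apply`). [cite: Rogawski1990, §4.8 p. 51; §12.2 p. 173] [cite: Liu2021, Def. 4.1 (l. 1900–1902); Def. 4.11 (l. 2086)]
[cite: ClozelHarrisTaylor2008, Lemma 4.1.1 (p. 116)] [cite: CasselsFrohlichANT1967, Ch. VII §5] -/
theorem exists_isConjugateSymplectic_semilocalComponent_eq (v : HeightOneSpectrum (𝓞 ↥(maximalRealSubfield L)))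
    (hns : ∀ w : UnitaryGroup.PlacesOver L v, IsCMField.complexConj L • w.1 = w.1) (μ' : (UnitaryGroup.LocalRing L v)ˣ →* ℂˣ)
    (hμ' : UnitaryGroup.IsQuadraticCharExtension (UnitaryGroup.conjLocal L (IsCMField.complexConj L) v) μ') (hμ'c : Continuous fun x => ((μ' x : ℂˣ) : ℂ)) :
    ∃ μ : IdeleClassGroup L →ₜ* Circle, IsConjugateSymplectic L μ ∧ (toHeckeCharacter L μ).semilocalComponent L v = μ' := by
  classical
  obtain ⟨w⟩ : Nonempty (UnitaryGroup.PlacesOver L v) := inferInstance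
  have hw := hns w
  haveI : Subsingleton (UnitaryGroup.PlacesOver L v) :=
    UnitaryGroup.PlacesOver.subsingleton_of_smul_eq (IsCMField.complexConj L) (IsCMField.complexConj_ne_one L) w hw
  -- a conjugate-symplectic `ψ₀` with an infinity type
  obtain ⟨Φ⟩ := (CMTypeCount.nonempty_cmType_iff_isTotallyComplex (K := L)).2 inferInstance
  obtain ⟨ψ₀, hψ₀, he₀⟩ := exists_isConjugateSymplectic_hasInfinityType Φ
  set χ₀ : HeckeCharacter L := toHeckeCharacter L ψ₀ with hχ₀
  have hχ₀bc : ∀ x : ideleGroup ↥(maximalRealSubfield L),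
      χ₀ (AdeleRing.ideleBaseChange (↥(maximalRealSubfield L)) L x) = quadraticHeckeCharCM L x := fun x => by
    have h := (isOscillatorChar_toHeckeCharacter_iff ψ₀).2 hψ₀ x
    rw [pow_one] at h
    exact h
  have hq₀ : UnitaryGroup.IsQuadraticCharExtension (UnitaryGroup.conjLocal L (IsCMField.complexConj L) v) (χ₀.semilocalComponent L v) :=
    Rogawski1990.isQuadraticCharExtension_semilocalComponent_of_baseChange_eq χ₀ hχ₀bc v
  -- `λ := μ′ / ψ₀,v` kills the `c ⊗ 1`-fixed units
  set lam : (UnitaryGroup.LocalRing L v)ˣ →* ℂˣ := μ' * (χ₀.semilocalComponent L v)⁻¹ with hlam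
  have hlam_apply : ∀ x, lam x = μ' x * (χ₀.semilocalComponent L v x)⁻¹ := fun _ => rfl
  have hsq : ∀ (ν : (UnitaryGroup.LocalRing L v)ˣ →* ℂˣ), UnitaryGroup.IsQuadraticCharExtension (UnitaryGroup.conjLocal L (IsCMField.complexConj L) v) ν →
      ∀ x : (UnitaryGroup.LocalRing L v)ˣ, UnitaryGroup.conjLocal L (IsCMField.complexConj L) v (x : UnitaryGroup.LocalRing L v) = x → ν x ^ 2 = 1 := by
    intro ν hν x hx
    rw [sq, ← map_mul]
    refine (hν (x * x) ?_).2 ⟨x, ?_⟩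
    · rw [Units.val_mul, map_mul, hx]
    · rw [Units.val_mul, hx]
  have hlamfix : ∀ x : (UnitaryGroup.LocalRing L v)ˣ, UnitaryGroup.conjLocal L (IsCMField.complexConj L) v (x : UnitaryGroup.LocalRing L v) = x → lam x = 1 := by
    intro x hx
    have key : μ' x = χ₀.semilocalComponent L v x :=
      units_eq_of_sq_eq_one (hsq μ' hμ' x hx) (hsq _ hq₀ x hx) ((hμ' x hx).trans (hq₀ x hx).symm)
    rw [hlam_apply, key, mul_inv_cancel]
  -- transfer to the completion `L_w` at the unique place `w ∣ v`
  set σw := galAdicCompletionEquiv (L := L) (IsCMField.complexConj L) hw with hσw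
  let ι : (w.1.adicCompletion L)ˣ →* (UnitaryGroup.LocalRing L v)ˣ :=
    MulEquiv.piUnits.symm.toMonoidHom.comp (MonoidHom.mulSingle (fun w' : UnitaryGroup.PlacesOver L v => (w'.1.adicCompletion L)ˣ) w)
  have hιw : ∀ a : (w.1.adicCompletion L)ˣ, ((ι a : (UnitaryGroup.LocalRing L v)ˣ) : UnitaryGroup.LocalRing L v) w = (a : w.1.adicCompletion L) := fun a => by
    simp [ι]
  have hπι : ∀ a, Units.map (Pi.evalMonoidHom (fun w' : UnitaryGroup.PlacesOver L v => w'.1.adicCompletion L) w) (ι a) = a := fun a =>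
    Units.ext (hιw a)
  have hιπ : ∀ x, ι (Units.map (Pi.evalMonoidHom (fun w' : UnitaryGroup.PlacesOver L v => w'.1.adicCompletion L) w) x) = x := fun x => by
    apply Units.ext
    funext w'
    obtain rfl : w' = w := Subsingleton.elim _ _
    rw [hιw]
    rfl
  have hιc : Continuous ι := by
    change Continuous fun a => (ContinuousMulEquiv.piUnits (M := fun w' : UnitaryGroup.PlacesOver L v => w'.1.adicCompletion L)).symm
      (Pi.mulSingle w a)
    have hms : Continuous fun a : (w.1.adicCompletion L)ˣ =>
        (Pi.mulSingle w a : ∀ w' : UnitaryGroup.PlacesOver L v, (w'.1.adicCompletion L)ˣ) :=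
      _root_.continuous_mulSingle (A := fun w' : UnitaryGroup.PlacesOver L v => (w'.1.adicCompletion L)ˣ)
        (T := fun w' => Units.instTopologicalSpaceUnits) w
    exact (ContinuousMulEquiv.piUnits (M := fun w' : UnitaryGroup.PlacesOver L v => w'.1.adicCompletion L)).symm.continuous.comp hms
  set Λ : (w.1.adicCompletion L)ˣ →* ℂˣ := lam.comp ι with hΛ
  have hΛc : Continuous Λ := by
    have hμ'u : Continuous μ' := Units.isEmbedding_val₀.continuous_iff.2 hμ'c
    have hs : Continuous (χ₀.semilocalComponent L v) := UnitaryGroup.continuous_semilocalComponent L χ₀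
    have hlamc : Continuous lam := by
      change Continuous fun x => (μ' * (χ₀.semilocalComponent L v)⁻¹) x
      simp only [MonoidHom.mul_apply, MonoidHom.inv_apply]
      exact hμ'u.mul hs.inv
    exact hlamc.comp hιc
  have hΛfix : ∀ a : (w.1.adicCompletion L)ˣ, σw a = a → Λ a = 1 := by
    intro a ha
    refine hlamfix (ι a) (funext fun w' => ?_)
    obtain rfl : w' = w := Subsingleton.elim _ _
    rw [UnitaryGroup.conjLocal_apply_eq_of_smul_eq (IsCMField.complexConj L) (IsCMField.complexConj_ne_one L) v w' hw, hιw]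
    exact ha
  -- §1 at `L_w`
  obtain ⟨θw, hθwker, hθwfin, hθwΛ⟩ := LocalAntiInvariantCharacter.exists_isOfFinOrder_apply_mul_inv_eq w.1 σw
    (fun x => UnitaryGroup.galAdicCompletionMap_galAdicCompletionMap_of_smul_eq (IsCMField.complexConj L) w
      (IsCMField.complexConj_ne_one L) hw x)
    (valued_galAdicCompletionMap L (IsCMField.complexConj L) hw) Λ hΛc hΛfix
  -- globalise `θ_w` ([ClozelHarrisTaylor2008, Lem. 4.1.1])
  obtain ⟨θ, hθfin, hθloc⟩ := GaloisRepresentations.ClozelHarrisTaylor2008.exists_heckeCharacter_isFiniteOrder_localComponent_eq {w.1}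
    (Pi.mulSingle (M := fun v' : HeightOneSpectrum (𝓞 L) => (v'.adicCompletion L)ˣ →* ℂˣ) w.1 θw) (by
      intro v' hv'
      rw [Finset.mem_singleton] at hv'
      subst hv'
      rw [Pi.mulSingle_eq_same]
      exact ⟨hθwker, hθwfin⟩)
  have hθw : θ.localComponent w.1 = θw := by rw [hθloc w.1 (Finset.mem_singleton_self _), Pi.mulSingle_eq_same]
  -- twist `ψ₀`
  obtain ⟨ψ, hψ, -, hψH⟩ := exists_twist_of_isFiniteOrder L hθfin ψ₀ hψ₀ he₀
  refine ⟨ψ, hψ, MonoidHom.ext fun x => ?_⟩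
  rw [semilocalComponent_eq_localMu, hψH, localMu_mul_twist_apply L v χ₀ θ w hw x, hθw, ← semilocalComponent_eq_localMu]
  have key := hθwΛ (Units.map (Pi.evalMonoidHom (fun w' : UnitaryGroup.PlacesOver L v => w'.1.adicCompletion L) w) x)
  rw [show galAdicCompletionUnitsEquiv (L := L) (IsCMField.complexConj L) hw = Units.mapEquiv σw.toMulEquiv from rfl, key, hΛ,
    MonoidHom.comp_apply, hιπ, hlam_apply, mul_comm (μ' x), mul_inv_cancel_left]

end CM

end IdeleClassGroup

end Literature.NumberTheory.Automorphic

end
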